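import Literature.AnabelianGeometry.SemiGraphs.BouquetOneCoverings
import Literature.AnabelianGeometry.SemiGraphs.PathCoverZMT

/-!
# Proof of [SemiAnbd] Remark 1.5.1 (1): the nonarchimedean condition `n ∣ d`

Mochizuki, *Semi-graphs of anabelioids*, Publ. RIMS **42** (2006) 221–322, §1, Remark 1.5.1, author's
manuscript pp. 18–19 [cite: MochizukiSemiAnbd2006, Rem. 1.5.1(1) p.19]: "(1) The case where `φ` itself
is a finite graph-covering, of degree `n`.  In this case, the resulting condition on `d` [for the
covering `C_d → H_1` to have the property of Theorem 1.2 (ii) relative to `φ`] is *nonarchimedean*,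
i.e.: `d ≡ 0 (mod n)`."

This file DISCHARGES the named fact `SemiGraph.remark_1_5_1_nonarchimedean` of
`ZariskiMainTheorem.lean` (statement by abc-iut-L3-t1).  By `exists_cyclicIndex`
(`BouquetOneCoverings.lean`) the connected degree-`n` covering `G` of `H_1` is an `n`-cycle: there is a
bijective index `idx : 𝒱_G → ℤ/n` increasing by `1` along every edge.  On `G ×_{H_1} C_d` the lift
of an edge from `(v, k)` ends at `(v', k + 1)` with `idx v' = idx v + 1`.  If `n ∣ d`, the quantity
`(k mod n) − idx v ∈ ℤ/n` is constant along the barycentric subdivision, hence on every connected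
sub-semi-graph `H`, so `H` has at most one vertex (edge) over each vertex (edge) of `C_d` and embeds
(`isEmbedding_of_injective`).  If `n ∤ d`, lifting the cycle `d` steps from `(idx⁻¹ 0, 0)` gives a
connected sub-semi-graph containing the distinct vertices `(idx⁻¹ 0, 0)` and `(idx⁻¹ d, 0)` over the
same vertex of `C_d`, which therefore does not embed.  Proof-only (no definitions).
-/

namespace Literature.AnabelianGeometry.SemiGraphs

namespace SemiGraph

open CategoryTheory

universe u

/-- DISCHARGE of `remark_1_5_1_nonarchimedean` ([SemiAnbd] Remark 1.5.1 (1)): for a connected finite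
graph-covering `φ : G → H_1` of degree `n`, the degree-`d` cycle `C_d → H_1` has the property of
Theorem 1.2 (ii) relative to `φ` iff `n ∣ d`. [cite: MochizukiSemiAnbd2006, Rem. 1.5.1(1) p.19] -/
theorem remark_1_5_1_nonarchimedean_holds : remark_1_5_1_nonarchimedean.{u} := by
  intro G φ n d hn hd hG hcov hcard
  classical
  haveI : NeZero d := ⟨by omega⟩
  haveI : NeZero n := ⟨by omega⟩
  have hexc : IsExcision φ := hcov.1.2
  obtain ⟨idx, out, hidx, hout, houtdir, habuts, hedge⟩ := exists_cyclicIndex φ hn hG hcov hcard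
  -- notation
  let C := cycleCover.{u} d
  let π := cycleCoverHom.{u} d
  let P := pullback φ π
  let tgt : G.Branch → G.Vertex := fun b => (G.abuts b).get (habuts b)
  have htgt : ∀ b, G.abuts b = some (tgt b) := fun b => (Option.some_get (habuts b)).symm
  -- branches of an edge by direction
  let eb : ∀ (e : G.Edge) (δ : Bool), {b : G.Branch // G.edgeOf b = e} := fun e δ =>
    (Equiv.ofBijective _ (dir_bijective φ e)).symm δ
  have heb_dir : ∀ e δ, (φ.branchMap (eb e δ).1).down.2 = δ := fun e δ =>
    (Equiv.ofBijective _ (dir_bijective φ e)).apply_symm_apply δ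
  have heb_uniq : ∀ (e : G.Edge) (δ : Bool) (b : G.Branch), G.edgeOf b = e →
      (φ.branchMap b).down.2 = δ → b = (eb e δ).1 := by
    intro e δ b he hδ
    have := (Equiv.ofBijective _ (dir_bijective φ e)).injective
      ((show (Equiv.ofBijective _ (dir_bijective φ e)) ⟨b, he⟩ = δ from hδ).trans
        ((Equiv.ofBijective _ (dir_bijective φ e)).apply_symm_apply δ).symm)
    exact congrArg Subtype.val this
  -- two branches at the same vertex with the same direction coincide (excision)
  have hvert_uniq : ∀ (b b' : G.Branch) (v : G.Vertex), G.abuts b = some v → G.abuts b' = some v →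
      (φ.branchMap b).down.2 = (φ.branchMap b').down.2 → b = b' := by
    intro b b' v hb hb' hδ
    have := (hexc v).1 (a₁ := ⟨b, hb⟩) (a₂ := ⟨b', hb'⟩) (Subtype.ext (ULift.ext _ _
      (Prod.ext (Subsingleton.elim _ _) hδ)))
    exact congrArg Subtype.val this
  -- the source of an edge and the index step along it
  let src : G.Edge → G.Vertex := fun e => tgt (eb e true).1
  have hsrc_true : ∀ b : G.Branch, (φ.branchMap b).down.2 = true → tgt b = src (G.edgeOf b) := by
    intro b hδ
    change tgt b = tgt (eb (G.edgeOf b) true).1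
    rw [← heb_uniq _ true b rfl hδ]
  have hsrc_false : ∀ b : G.Branch, (φ.branchMap b).down.2 = false →
      idx (tgt b) = idx (src (G.edgeOf b)) + 1 :=
    fun b hδ => hedge (eb (G.edgeOf b) true).1 b (src (G.edgeOf b)) (tgt b) (htgt _)
      (heb_dir _ true) (by rw [(eb (G.edgeOf b) true).2]) hδ (htgt b)
  have hsrc_inj : Function.Injective src := by
    intro e e' h
    have := hvert_uniq (eb e true).1 (eb e' true).1 (src e) (htgt _) (h ▸ htgt _)
      ((heb_dir e true).trans (heb_dir e' true).symm)
    rw [← (eb e true).2, ← (eb e' true).2, this]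
  /- the pull-back: direction bits agree; every branch abuts -/
  have hdir : ∀ c : P.Branch, (φ.branchMap c.1.1).down.2 = c.1.2.down.2 := fun c =>
    congrArg (fun x : ULift (Fin 1 × Bool) => x.down.2) c.2
  have hab : ∀ c : P.Branch, P.abuts c = some
      ⟨(tgt c.1.1, ⟨if c.1.2.down.2 then c.1.2.down.1 else c.1.2.down.1 + 1⟩), rfl⟩ := by
    intro c
    change ((G.abuts c.1.1).bind fun v => (C.abuts c.1.2).bind fun v' =>
      if h : φ.vertexMap v = π.vertexMap v' then some (⟨(v, v'), h⟩ : P.Vertex) else none) = _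
    rw [htgt c.1.1]
    exact dif_pos rfl
  constructor
  · /- (⇒) if every connected sub-semi-graph embeds then `n ∣ d` -/
    intro hZ
    by_contra hnd
    let ν : ZMod n → G.Vertex := (Equiv.ofBijective idx hidx).symm
    have hν : ∀ k, idx (ν k) = k := (Equiv.ofBijective idx hidx).apply_symm_apply
    have hνidx : ∀ v, ν (idx v) = v := (Equiv.ofBijective idx hidx).symm_apply_apply
    -- the lifted cycle through `(ν 0, 0)`: vertices `(ν i, i)`, edges the leaving edges
    have hφe : ∀ e : G.Edge, φ.edgeMap e = π.edgeMap (⟨(0 : ZMod d)⟩ : C.Edge) := fun e =>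
      ULift.ext _ _ (Subsingleton.elim _ _)
    let vtx : ℕ → P.Vertex := fun i => ⟨(ν i, ⟨(i : ZMod d)⟩), rfl⟩
    let edgG : ℕ → G.Edge := fun i => G.edgeOf (out (ν i))
    let edg : ℕ → P.Edge := fun i => ⟨(edgG i, ⟨(i : ZMod d)⟩), (hφe _).trans rfl⟩
    have hbr_cond : ∀ (i : ℕ) (δ : Bool), φ.branchMap (eb (edgG i) δ).1 =
        π.branchMap (⟨((i : ZMod d), δ)⟩ : C.Branch) := fun i δ =>
      ULift.ext _ _ (Prod.ext (Subsingleton.elim _ _) (heb_dir _ δ))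
    let br : ℕ → Bool → P.Branch := fun i δ => ⟨((eb (edgG i) δ).1, ⟨((i : ZMod d), δ)⟩), hbr_cond i δ⟩
    let H : P.Subgraph :=
      { verts := Set.range fun i : Fin (d + 1) => vtx i
        edges := Set.range fun i : Fin d => edg i }
    have hvtx : ∀ i : ℕ, i < d + 1 → vtx i ∈ H.verts := fun i hi => ⟨⟨i, hi⟩, rfl⟩
    have hedg : ∀ i : ℕ, i < d → edg i ∈ H.edges := fun i hi => ⟨⟨i, hi⟩, rfl⟩
    have hbr_edge : ∀ (i : ℕ) (δ : Bool), P.edgeOf (br i δ) = edg i := fun i δ =>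
      Subtype.ext (Prod.ext (eb (edgG i) δ).2 rfl)
    have hout_eb : ∀ i : ℕ, out (ν i) = (eb (edgG i) true).1 :=
      fun i => heb_uniq _ true _ rfl (houtdir _)
    have hbr_true : ∀ i : ℕ, P.abuts (br i true) = some (vtx i) := by
      intro i
      rw [hab]
      congr 1
      apply Subtype.ext
      refine Prod.ext ?_ rfl
      change tgt (eb (edgG i) true).1 = ν i
      rw [← hout_eb]
      exact Option.some.inj ((htgt _).symm.trans (hout _))
    have hbr_false : ∀ i : ℕ, P.abuts (br i false) = some (vtx (i + 1)) := by
      intro i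
      rw [hab]
      congr 1
      apply Subtype.ext
      refine Prod.ext ?_ (congrArg ULift.up ?_)
      · change tgt (eb (edgG i) false).1 = ν ((i + 1 : ℕ) : ZMod n)
        have h1 := hsrc_false (eb (edgG i) false).1 (heb_dir _ false)
        rw [(eb (edgG i) false).2] at h1
        have h2 : src (edgG i) = ν i := by
          change tgt (eb (edgG i) true).1 = ν i
          rw [← hout_eb]
          exact Option.some.inj ((htgt _).symm.trans (hout _))
        rw [h2, hν] at h1
        rw [← hνidx (tgt _), h1, Nat.cast_succ]
      · change ((i : ℕ) : ZMod d) + 1 = (((i + 1 : ℕ)) : ZMod d)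
        push_cast
        ring
    have habH : ∀ (i : ℕ) (δ : Bool) (hi : i < d) (y : P.Vertex) (hy : y ∈ H.verts),
        P.abuts (br i δ) = some y →
        H.toSemiGraph.abuts ⟨br i δ, (hbr_edge i δ).symm ▸ hedg i hi⟩ = some ⟨y, hy⟩ := by
      intro i δ hi y hy h
      change (P.abuts (br i δ)).pbind _ = _
      simp only [h, Option.pbind_some]
      exact dif_pos hy
    -- connectivity from the vertex node `(ν 0, 0)`
    let v0 : H.toSemiGraph.Vertex := ⟨vtx 0, hvtx 0 (by omega)⟩
    have hreachV : ∀ (i : ℕ) (hi : i < d + 1), H.toSemiGraph.subdivision.Reachable (Sum.inl v0)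
        (Sum.inl ⟨vtx i, hvtx i hi⟩) := by
      intro i hi
      induction i with
      | zero => exact SimpleGraph.Reachable.refl _
      | succ i ih =>
        refine (ih (by omega)).trans ?_
        have hid : i < d := by omega
        have h1 : H.toSemiGraph.subdivision.Adj
            (Sum.inr (Sum.inr ⟨br i true, (hbr_edge i true).symm ▸ hedg i hid⟩))
            (Sum.inl ⟨vtx i, hvtx i (by omega)⟩) :=
          subdivision_adj_of_nodeRel _ (NodeRel.branch_vertex _ _
            (habH i true hid _ (hvtx i (by omega)) (hbr_true i)))
        have h2 : H.toSemiGraph.subdivision.Adj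
            (Sum.inr (Sum.inl (H.toSemiGraph.edgeOf ⟨br i true, (hbr_edge i true).symm ▸ hedg i hid⟩)))
            (Sum.inr (Sum.inr ⟨br i true, (hbr_edge i true).symm ▸ hedg i hid⟩)) :=
          subdivision_adj_of_nodeRel _ (NodeRel.edge_branch _)
        have h3 : H.toSemiGraph.subdivision.Adj
            (Sum.inr (Sum.inl (H.toSemiGraph.edgeOf
              ⟨br i false, (hbr_edge i false).symm ▸ hedg i hid⟩)))
            (Sum.inr (Sum.inr ⟨br i false, (hbr_edge i false).symm ▸ hedg i hid⟩)) :=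
          subdivision_adj_of_nodeRel _ (NodeRel.edge_branch _)
        have h4 : H.toSemiGraph.subdivision.Adj
            (Sum.inr (Sum.inr ⟨br i false, (hbr_edge i false).symm ▸ hedg i hid⟩))
            (Sum.inl ⟨vtx (i + 1), hvtx (i + 1) hi⟩) :=
          subdivision_adj_of_nodeRel _ (NodeRel.branch_vertex _ _
            (habH i false hid _ (hvtx (i + 1) hi) (hbr_false i)))
        have he : H.toSemiGraph.edgeOf ⟨br i true, (hbr_edge i true).symm ▸ hedg i hid⟩ =
            H.toSemiGraph.edgeOf ⟨br i false, (hbr_edge i false).symm ▸ hedg i hid⟩ :=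
          Subtype.ext ((hbr_edge i true).trans (hbr_edge i false).symm)
        rw [he] at h2
        exact h1.symm.reachable.trans (h2.symm.reachable.trans (h3.reachable.trans h4.reachable))
    have hconn : H.toSemiGraph.IsConnected := by
      haveI : Nonempty H.toSemiGraph.Node := ⟨Sum.inl v0⟩
      suffices hall : ∀ a : H.toSemiGraph.Node, H.toSemiGraph.subdivision.Reachable (Sum.inl v0) a from
        ⟨⟨fun a b => (hall a).symm.trans (hall b)⟩⟩
      intro a
      rcases a with ⟨y, hy⟩ | ⟨y, hy⟩ | ⟨c, hc⟩
      · obtain ⟨⟨i, hi⟩, rfl⟩ := hy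
        exact hreachV i hi
      · obtain ⟨⟨i, hi⟩, rfl⟩ := hy
        have h1 : H.toSemiGraph.subdivision.Adj
            (Sum.inr (Sum.inr ⟨br i true, (hbr_edge i true).symm ▸ hedg i hi⟩))
            (Sum.inl ⟨vtx i, hvtx i (by omega)⟩) :=
          subdivision_adj_of_nodeRel _ (NodeRel.branch_vertex _ _
            (habH i true hi _ (hvtx i (by omega)) (hbr_true i)))
        have h2 : H.toSemiGraph.subdivision.Adj
            (Sum.inr (Sum.inl (H.toSemiGraph.edgeOf ⟨br i true, (hbr_edge i true).symm ▸ hedg i hi⟩)))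
            (Sum.inr (Sum.inr ⟨br i true, (hbr_edge i true).symm ▸ hedg i hi⟩)) :=
          subdivision_adj_of_nodeRel _ (NodeRel.edge_branch _)
        have he : H.toSemiGraph.edgeOf ⟨br i true, (hbr_edge i true).symm ▸ hedg i hi⟩ =
            ⟨edg i, hedg i hi⟩ := Subtype.ext (hbr_edge i true)
        rw [he] at h2
        exact (hreachV i (by omega)).trans (h1.symm.reachable.trans h2.symm.reachable)
      · obtain ⟨⟨i, hi⟩, hj⟩ := id hc
        -- `c` is `br i δ` with `δ` its direction bit
        have hcG : G.edgeOf c.1.1 = edgG i := congrArg (fun e : P.Edge => e.1.1) hj.symm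
        have hcC : C.edgeOf c.1.2 = ⟨((i : ℕ) : ZMod d)⟩ := congrArg (fun e : P.Edge => e.1.2) hj.symm
        have hcb : c = br i c.1.2.down.2 := by
          apply Subtype.ext
          refine Prod.ext ?_ (congrArg ULift.up (Prod.ext ?_ rfl))
          · exact heb_uniq _ _ _ hcG (hdir c)
          · exact congrArg ULift.down hcC
        have hmem : P.edgeOf (br i c.1.2.down.2) ∈ H.edges := (hbr_edge i _).symm ▸ hedg i hi
        have hnode : (Sum.inr (Sum.inr ⟨c, hc⟩) : H.toSemiGraph.Node) =
            Sum.inr (Sum.inr ⟨br i c.1.2.down.2, hmem⟩) := by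
          congr 2
          exact Subtype.ext hcb
        rw [hnode]
        have h2 : H.toSemiGraph.subdivision.Adj
            (Sum.inr (Sum.inl (H.toSemiGraph.edgeOf ⟨br i c.1.2.down.2, hmem⟩)))
            (Sum.inr (Sum.inr ⟨br i c.1.2.down.2, hmem⟩)) :=
          subdivision_adj_of_nodeRel _ (NodeRel.edge_branch _)
        have he : H.toSemiGraph.edgeOf ⟨br i c.1.2.down.2, hmem⟩ = ⟨edg i, hedg i hi⟩ :=
          Subtype.ext (hbr_edge i _)
        rw [he] at h2
        have h1 : H.toSemiGraph.subdivision.Adj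
            (Sum.inr (Sum.inr ⟨br i true, (hbr_edge i true).symm ▸ hedg i hi⟩))
            (Sum.inl ⟨vtx i, hvtx i (by omega)⟩) :=
          subdivision_adj_of_nodeRel _ (NodeRel.branch_vertex _ _
            (habH i true hi _ (hvtx i (by omega)) (hbr_true i)))
        have h3 : H.toSemiGraph.subdivision.Adj
            (Sum.inr (Sum.inl (H.toSemiGraph.edgeOf ⟨br i true, (hbr_edge i true).symm ▸ hedg i hi⟩)))
            (Sum.inr (Sum.inr ⟨br i true, (hbr_edge i true).symm ▸ hedg i hi⟩)) :=
          subdivision_adj_of_nodeRel _ (NodeRel.edge_branch _)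
        have he' : H.toSemiGraph.edgeOf ⟨br i true, (hbr_edge i true).symm ▸ hedg i hi⟩ =
            ⟨edg i, hedg i hi⟩ := Subtype.ext (hbr_edge i true)
        rw [he'] at h3
        exact (hreachV i (by omega)).trans
          (h1.symm.reachable.trans (h3.symm.reachable.trans h2.reachable))
    -- `(ν 0, 0)` and `(ν d, d) = (ν d, 0)` are distinct vertices of `H` over the same vertex of `C_d`
    have hinj := (hZ H hconn).vertexMap_injective
    have heq : (H.ι ≫ pullback.snd φ π).vertexMap ⟨vtx 0, hvtx 0 (by omega)⟩ =
        (H.ι ≫ pullback.snd φ π).vertexMap ⟨vtx d, hvtx d (by omega)⟩ := by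
      change (⟨((0 : ℕ) : ZMod d)⟩ : ULift (ZMod d)) = ⟨((d : ℕ) : ZMod d)⟩
      rw [ZMod.natCast_self, Nat.cast_zero]
    have h1 := congrArg (fun x : H.toSemiGraph.Vertex => idx x.1.1.1) (hinj heq)
    change idx (ν ((0 : ℕ) : ZMod n)) = idx (ν ((d : ℕ) : ZMod n)) at h1
    rw [hν, hν, Nat.cast_zero, eq_comm, ZMod.natCast_eq_zero_iff] at h1
    exact hnd h1
  · /- (⇐) if `n ∣ d`, every connected sub-semi-graph embeds: the invariant `(k mod n) - idx v` -/
    intro hnd H hH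
    let κ : ZMod d →+* ZMod n := ZMod.castHom hnd (ZMod n)
    let qV : P.Vertex → ZMod n := fun y => κ y.1.2.down - idx y.1.1
    let qE : P.Edge → ZMod n := fun y => κ y.1.2.down - idx (src y.1.1)
    let qB : P.Branch → ZMod n := fun c => κ c.1.2.down.1 - idx (src (G.edgeOf c.1.1))
    have hPV : ∀ (c : P.Branch) (y : P.Vertex), P.abuts c = some y → qV y = qB c := by
      intro c y h
      rw [hab c] at h
      cases h
      change κ (if c.1.2.down.2 then c.1.2.down.1 else c.1.2.down.1 + 1) - idx (tgt c.1.1) =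
        κ c.1.2.down.1 - idx (src (G.edgeOf c.1.1))
      rcases hδ : c.1.2.down.2 with _ | _
      · rw [hsrc_false c.1.1 ((hdir c).trans hδ)]
        simp only [Bool.false_eq_true, ↓reduceIte, map_add, map_one]
        ring
      · rw [hsrc_true c.1.1 ((hdir c).trans hδ)]
        simp
    let q : H.toSemiGraph.Node → ZMod n := fun x =>
      match x with
      | Sum.inl x => qV x.1
      | Sum.inr (Sum.inl y) => qE y.1
      | Sum.inr (Sum.inr z) => qB z.1
    have hstep : ∀ a b : H.toSemiGraph.Node, H.toSemiGraph.NodeRel a b → q a = q b := by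
      intro a b hr
      cases hr with
      | edge_branch z => rfl
      | branch_vertex z x h => exact (hPV z.1 x.1 (H.ι.abuts_branchMap z x h)).symm
    have hq : ∀ a b : H.toSemiGraph.Node, q a = q b := by
      intro a b
      obtain ⟨w⟩ := hH.connected a b
      induction w with
      | nil => rfl
      | cons hadj _ ih =>
        refine Eq.trans ?_ ih
        rcases (SimpleGraph.fromRel_adj _ _ _).1 hadj with ⟨-, hr | hr⟩
        · exact hstep _ _ hr
        · exact (hstep _ _ hr).symm
    refine isEmbedding_of_injective _ (fun x y h => ?_) (fun x y h => ?_) (fun z x h => ?_)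
    · -- vertices over the same vertex of `C_d`
      change x.1.1.2 = y.1.1.2 at h
      have hxy := hq (Sum.inl x) (Sum.inl y)
      change qV x.1 = qV y.1 at hxy
      have hj : idx x.1.1.1 = idx y.1.1.1 := by
        have := hxy
        simp only [qV, h] at this
        exact sub_right_injective this
      exact Subtype.ext (Subtype.ext (Prod.ext (hidx.1 hj) h))
    · -- edges over the same edge of `C_d`
      change x.1.1.2 = y.1.1.2 at h
      have hxy := hq (Sum.inr (Sum.inl x)) (Sum.inr (Sum.inl y))
      change qE x.1 = qE y.1 at hxy
      have hj : idx (src x.1.1.1) = idx (src y.1.1.1) := by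
        have := hxy
        simp only [qE, h] at this
        exact sub_right_injective this
      exact Subtype.ext (Subtype.ext (Prod.ext (hsrc_inj (hidx.1 hj)) h))
    · -- abutment is reflected
      change C.abuts z.1.1.2 = some x.1.1.2 at h
      have hy := hab z.1
      have hC := (pullback.snd φ π).abuts_branchMap z.1 _ hy
      change C.abuts z.1.1.2 = some _ at hC
      rw [h] at hC
      have hk := congrArg ULift.down (Option.some.inj hC)
      have hqx : qV x.1 = qB z.1 := hq (Sum.inl x) (Sum.inr (Sum.inr z))
      have hqy := hPV z.1 _ hy
      have hj : idx x.1.1.1 = idx (tgt z.1.1.1) := by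
        have h1 := hqx.trans hqy.symm
        simp only [qV] at h1
        rw [hk] at h1
        exact sub_right_injective h1
      have hxv : x.1 = ⟨(tgt z.1.1.1,
          ⟨if z.1.1.2.down.2 then z.1.1.2.down.1 else z.1.1.2.down.1 + 1⟩), rfl⟩ :=
        Subtype.ext (Prod.ext (hidx.1 hj) (ULift.ext _ _ hk))
      have hQ : P.abuts z.1 = some x.1 := by rw [hxv]; exact hy
      change (P.abuts z.1).pbind _ = _
      simp only [hQ, Option.pbind_some]
      exact dif_pos x.2

end SemiGraph

end Literature.AnabelianGeometry.SemiGraphs
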